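import Literature.NumberTheory.Transcendental.L2HodgeTheoryExactCoexactProofs
import HarnessLib

/-!
# `δ` is the formal adjoint of `d` in `L²`: corrected named fact (Warner (1983), Prop. 6.2)

Companion of `Literature/NumberTheory/Transcendental/L2HodgeTheory.lean` (§*Analytic statements
on a closed oriented Riemannian manifold*) and of the proof files
`Literature/Geometry/Kaehler/RiemannianHodgeAdjointProofs.lean` (Prop. 6.2 in wedge form,
`Literature.Geometry.Kaehler.integral_mextDeriv_wedge_hodgeStar`: `∫_M dα ∧ ⋆β = ∫_M α ∧ ⋆δβ`)
and `Literature/NumberTheory/Transcendental/L2HodgeTheoryExactCoexactProofs.lean` (Prop. 6.2 in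
`L²` form, `Literature.Geometry.Kaehler.MForm.l2Inner_mextDeriv_left_of_isSmoothForm`).

The named fact `Literature.Geometry.Kaehler.MForm.l2Inner_mextDeriv_left` ("`δ` is the formal
adjoint of `d`: `⟪dα, β⟫_{L²} = ⟪α, δβ⟫_{L²}`", F. W. Warner, *Foundations of Differentiable
Manifolds and Lie Groups*, GTM 94, Prop. 6.2, pp. 220–221) is a `def … : Prop` written inside
`section Closed` of `L2HodgeTheory.lean`, after
`variable [CompactSpace M] [I.Boundaryless] [IsContinuousRiemannianBundle E _]
[IsContMDiffRiemannianBundle I ∞ E _]`. A `def` abstracts only the section variables its body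
*uses*, and none of these four instances is used by `l2Inner`, `mextDeriv`, `mcoderiv` or
`IsSmoothForm`: the elaborated constant binds exactly
`[FiniteDimensional ℝ E] [Fact (finrank ℝ E = n)] [MeasurableSpace E] [BorelSpace E] [T2Space M]
[SigmaCompactSpace M] [IsManifold I ∞ M] [RiemannianBundle _] (o) {k m}` (checked by printing its
type). As elaborated it therefore asserts Prop. 6.2 for *every* Hausdorff σ-compact `C^∞`
manifold — non-compact ones (where `MForm.integral` is a junk value) and manifolds with boundary
included — and for fibre metrics of no regularity, whereas Warner's standing hypothesis for Ch. 6
is "`M` will be a compact oriented Riemannian manifold of dimension `n`" (p. 220, first sentence;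
metrics smooth, 4.10; no boundary). In that generality the statement is **false**: on the compact
interval `M = [0, 1]` (model `𝓡∂ 1`, flat metric, constant orientation, `vol = dx` smooth) take
the smooth `0`-form `α = x` and the smooth `1`-form `β = dx`; then `dα = dx`, `δβ = -⋆d⋆dx =
-⋆d1 = 0`, so `⟪dα, β⟫ = ∫₀¹ dx = 1 ≠ 0 = ⟪α, δβ⟫` — the boundary term `[αβ]₀¹` of Stokes'
theorem, which the closed-manifold hypothesis removes; for a metric of no regularity `d⋆β` is the
junk value `0` of the `fderivWithin`-based `mextDeriv` wherever `⋆β` is not differentiable (cf.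
the refutations `RiemannianHodgeRoughMetric.lean`, `RiemannianHodgeSmoothCounterexample.lean` of
the sibling facts `isSmoothForm_hodgeStar`, `isSmoothForm_mcoderiv`). The same dropped-instance
defect affects every `def` of that section (see the module docstring of
`L2HodgeTheoryExactCoexactProofs.lean`).

Following D-0014 the original def is left untouched; this file vendors the **corrected, closed
statement** `Literature.Geometry.Kaehler.MForm.l2Inner_mextDeriv_left_of_isClosedManifold`
(Warner's hypotheses `[CompactSpace M] [I.Boundaryless] [IsContinuousRiemannianBundle E _]
[IsContMDiffRiemannianBundle I ∞ E _]`, together with `[T2Space M] [IsManifold I ∞ M]`, bound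
*inside* the statement) and discharges it (`…_of_isClosedManifold_holds`) by
`MForm.l2Inner_mextDeriv_left_of_isSmoothForm`, i.e. by Warner's printed proof:
`d(α ∧ ⋆β) = dα ∧ ⋆β - α ∧ ⋆δβ` (Leibniz rule, `⋆⋆ = ±1` and the sign in `δ`), Stokes
`∫_M d(α ∧ ⋆β) = 0` on the closed manifold (`integral_mextDeriv_wedge_hodgeStar`), and
`α ∧ ⋆β = ⟪α, β⟫ vol` (`MForm.wedge_hodgeStar`, Ch. 2, Exercise 13 (6), p. 80). It also records
the bridge `Literature.Geometry.Kaehler.MForm.l2Inner_mextDeriv_left_of_compactSpace`: under the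
intended instances the named fact *as declared* holds.

## References

* F. W. Warner, *Foundations of Differentiable Manifolds and Lie Groups*, GTM 94, Springer
  (1983): Ch. 6, standing hypothesis p. 220; 6.1 (1), (2), (5), p. 220; Prop. 6.2 and its proof,
  pp. 220–221; Ch. 2, Exercise 13 (6), p. 80.

## Verdict clean-up note (2026-08-15)

The named fact `MForm.l2Inner_mextDeriv_left` is now an `@[deprecated]` record of
`L2HodgeTheory.lean` (mis-stated, resp. refuted as stated: a `def` does not abstract the unused
section instances it was written under; the corrected statements are the ones proved or named in
this file and in the records' docstrings). The declaration `l2Inner_mextDeriv_left_of_compactSpace`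
names the record on purpose, so `linter.deprecated` is silenced on exactly that declaration
(REMOVE-WHEN the records are deleted from `L2HodgeTheory.lean`).
-/

noncomputable section

open scoped Manifold ContDiff Topology
open Bundle Module
open Literature.Geometry.Kaehler

namespace Literature.NumberTheory.Transcendental

/-! ### The named fact as declared, under the intended instances -/

section Bridge

variable {E : Type*} [NormedAddCommGroup E] [NormedSpace ℝ E] [FiniteDimensional ℝ E]
  {n : ℕ} [Fact (finrank ℝ E = n)] [MeasurableSpace E] [BorelSpace E]
  {H : Type*} [TopologicalSpace H] {I : ModelWithCorners ℝ E H}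
  {M : Type*} [TopologicalSpace M] [ChartedSpace H M] [T2Space M] [CompactSpace M]
  [IsManifold I ∞ M] [I.Boundaryless] [RiemannianBundle (fun x : M ↦ TangentSpace I x)]
  [IsContinuousRiemannianBundle E (fun x : M ↦ TangentSpace I x)]
  [IsContMDiffRiemannianBundle I ∞ E (fun x : M ↦ TangentSpace I x)]
  (o : (x : M) → Orientation ℝ (TangentSpace I x) (Fin n)) {k m : ℕ}

-- names the `@[deprecated]` record `MForm.l2Inner_mextDeriv_left` on purpose (verdict clean-up 2026-08-15); REMOVE-WHEN the
-- record is deleted from `L2HodgeTheory.lean`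
set_option linter.deprecated false in
/-- **Bridge to the named fact as declared.** In the presence of the intended instances
(`CompactSpace M`, `I.Boundaryless`, continuous and `C^∞` Riemannian metric — Warner's standing
hypotheses for Ch. 6, p. 220) the named fact `MForm.l2Inner_mextDeriv_left o` of
`L2HodgeTheory.lean` — whose `def` dropped exactly these instances, see the module docstring —
holds: its body quantifies `ho`, `h`, `α`, `β` itself and is then
`MForm.l2Inner_mextDeriv_left_of_isSmoothForm` (Warner (1983), Prop. 6.2, pp. 220–221:
`⟨dα, β⟩ = ⟨α, δβ⟩`). [cite: WarnerGTM94, Prop. 6.2, pp. 220–221] -/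
theorem _root_.Literature.Geometry.Kaehler.MForm.l2Inner_mextDeriv_left_of_compactSpace :
    MForm.l2Inner_mextDeriv_left (k := k) (m := m) o :=
  fun ho h _ _ hα hβ ↦ MForm.l2Inner_mextDeriv_left_of_isSmoothForm o ho h hα hβ

end Bridge

/-! ### The corrected named fact (Warner, Prop. 6.2) -/

section CorrectedFact

/-- **Warner's Proposition 6.2 — `δ` is the formal adjoint of `d` — as a closed named fact,
correctly stated.** On a compact oriented Riemannian manifold `M` without boundary (Hausdorff,
`C^∞` manifold, continuous and `C^∞` metric, orientation family `o` with `vol_o` smooth), for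
every smooth `k`-form `α` and smooth `(k+1)`-form `β` (degrees via `h : (k + 1) + m = n`, as for
`mcoderiv`), `⟪dα, β⟫_{L²} = ⟪α, δβ⟫_{L²}`, where `⟪α, β⟫_{L²} = ∫_M ⟪α, β⟫ vol_o`
(`MForm.l2Inner`) — F. W. Warner, *Foundations of Differentiable Manifolds and Lie Groups*, GTM 94
(1983), Prop. 6.2, pp. 220–221: "`δ` is the adjoint of `d` on `⊕ E^p(M)`; that is,
`⟨dα, β⟩ = ⟨α, δβ⟩`", proved from `d(α ∧ *β) = dα ∧ *β - α ∧ *δβ` and Stokes; standing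
hypothesis p. 220: "`M` will be a compact oriented Riemannian manifold of dimension `n`".
**Correction** of the named fact `Literature.Geometry.Kaehler.MForm.l2Inner_mextDeriv_left` of
`L2HodgeTheory.lean`: that `def … : Prop` was written after
`variable [CompactSpace M] [I.Boundaryless] [IsContinuousRiemannianBundle E _]
[IsContMDiffRiemannianBundle I ∞ E _]`, but a `def` does not abstract unused section instances,
so its elaborated statement binds only `[T2Space M] [SigmaCompactSpace M] [IsManifold I ∞ M]
[RiemannianBundle _]`: it quantifies over non-compact manifolds (where `MForm.integral` is a junk
value), over manifolds with boundary (where it fails: on `[0, 1]`,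
`⟪dx, dx⟫ = 1 ≠ 0 = ⟪x, δ(dx)⟫`, the boundary term of Stokes) and over fibre metrics of no
regularity (where `d⋆β` is a junk value). Here these hypotheses (with `[T2Space M]
[IsManifold I ∞ M]`) are binders *of the statement*, whose body is otherwise that of the original.
Discharged by `l2Inner_mextDeriv_left_of_isClosedManifold_holds`; the usable form is
`Literature.Geometry.Kaehler.MForm.l2Inner_mextDeriv_left_of_isSmoothForm`
(`L2HodgeTheoryExactCoexactProofs.lean`). [cite: WarnerGTM94, Prop. 6.2, pp. 220–221] -/
def _root_.Literature.Geometry.Kaehler.MForm.l2Inner_mextDeriv_left_of_isClosedManifold : Prop :=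
  ∀ {E : Type*} [NormedAddCommGroup E] [NormedSpace ℝ E] [FiniteDimensional ℝ E] {n : ℕ}
    [Fact (finrank ℝ E = n)] [MeasurableSpace E] [BorelSpace E]
    {H : Type*} [TopologicalSpace H] {I : ModelWithCorners ℝ E H}
    {M : Type*} [TopologicalSpace M] [ChartedSpace H M] [T2Space M] [CompactSpace M]
    [IsManifold I ∞ M] [I.Boundaryless] [RiemannianBundle (fun x : M ↦ TangentSpace I x)]
    [IsContinuousRiemannianBundle E (fun x : M ↦ TangentSpace I x)]
    [IsContMDiffRiemannianBundle I ∞ E (fun x : M ↦ TangentSpace I x)] {k m : ℕ}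
    (o : (x : M) → Orientation ℝ (TangentSpace I x) (Fin n)),
    IsSmoothForm (riemannianVolumeForm o) → ∀ (h : (k + 1) + m = n) {α : MForm I M ℝ k}
      {β : MForm I M ℝ (k + 1)}, IsSmoothForm α → IsSmoothForm β →
        MForm.l2Inner o (mextDeriv α) β = MForm.l2Inner o α (mcoderiv o h β)

/-- **Discharge** of `MForm.l2Inner_mextDeriv_left_of_isClosedManifold` (the corrected form of
the named fact `MForm.l2Inner_mextDeriv_left`): immediate from
`MForm.l2Inner_mextDeriv_left_of_isSmoothForm` — Warner's proof of Prop. 6.2, pp. 220–221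
(`d(α ∧ ⋆β) = dα ∧ ⋆β - α ∧ ⋆δβ`, Stokes on the closed manifold, `α ∧ ⋆β = ⟪α, β⟫ vol`), carried
out in `RiemannianHodgeAdjointProofs.lean` (`integral_mextDeriv_wedge_hodgeStar`) and read in
`L²` form through `MForm.wedge_hodgeStar`. [cite: WarnerGTM94, Prop. 6.2, pp. 220–221] -/
theorem _root_.Literature.Geometry.Kaehler.MForm.l2Inner_mextDeriv_left_of_isClosedManifold_holds :
    MForm.l2Inner_mextDeriv_left_of_isClosedManifold :=
  fun o ho h _ _ hα hβ ↦ MForm.l2Inner_mextDeriv_left_of_isSmoothForm o ho h hα hβ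

end CorrectedFact

end Literature.NumberTheory.Transcendental
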